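import Summits.Ventures.QEDPrecision.Diagrams.VolkovOnShellSetsMinimal

/-!
Venture QEDPrecision / cell `pub-qed`, unit `pub-qed-int-2` (INT-2, gen 9). HONEST FRAMING: independent recomputation; certified
where stated, statistical where stated; no new-physics claim.  NEW WORK of the cell (a kernel-checked formal identity in the
unit's OWN model), not a published result: nothing here is cited as a fact anywhere; the printed sources are named only in
comments.
Staged copy: HOME/lean/int2/VolkovOnShellSetsGrouped.lean (declarations byte-identical).

# Closure and rigidity of LARGE sets of rows in kernel-sized pieces

`VolkovOnShellSets` / `VolkovOnShellSetsMinimal` certify `closes` (the residual `R^Volkov − R^on-shell` of a set of rows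
vanishes identically modulo the Ward identities) and `rigid` (forcing along a certificate of monomials ends with one class ⇒ no
proper non-empty subset closes) by ONE kernel evaluation per set.  At five loops a whole gauge-invariant class is too big for
one evaluation (the 55-graph class (1;2,2) already exceeds the kernel's memory: HOME/pub-qed-int-2/LEAN-ONSHELLSETS.md §5).
This file gives the two devices by which `VolkovOnShellSetsOrder10C122` / `…C131` / `…C131Closes` / `…C131Rigid` certify the
classes (1;2,2) and (1;3,1) piecewise, with nothing but `decide` and rewriting:
(1) CLOSURE BY A CHAIN OF LITERAL PARTIAL SUMS.  `blockResidual n rows (a ++ b)` is, by `List.foldr_append`, the fold of the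
rows `a` started from `blockResidual n rows b` (`blockResidual_append`; definitional — no algebra of polynomials is used).  So
`blockResidual` of a long list is certified suffix by suffix: each step evaluates one kernel-sized group of rows on top of the
previous suffix's value, and the suffix values are written into the file as LITERAL polynomials (`polyOf` / `polyOfIdx` of
STRUCTURAL monomials = lists of symbols (operator code: 1 = A′, 2 = L′, 3 = D′ = L′ − U′, 4 = δm′; word of the reduced graph as
in `VolkovOnShellSets`), summed by `psum`).  The last step is `closes … = true` for the whole list, literally.
(2) RIGIDITY FROM A CERTIFIED COLUMN TABLE.  `forceStep` only reads, per certificate monomial, the coefficient of that monomial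
in each class's residual sum.  `colTable n rows keys b` extracts, row by row (again a `foldr`, so again chainable through
literal suffix tables: `colTable_append`, `restrictCols`), the COLUMN of each key: the list of (row, coefficient) with non-zero
coefficient.  `forceCols` is `forceStep` with the class coefficient read off the column as the sum of the class's entries
(`classCoeff`) — which IS the coefficient of the monomial in the class's residual sum, coefficients being additive under `padd`
(canonical sparse forms: increasing monomials, no zero coefficient; `rowResidual` is canonical by construction, `pins` keeps
it).  `rigidCols b T`: from the partition of `b` into single rows, forcing column by column of `T` ends with ONE class.
SOUNDNESS is that of `rigid` verbatim (docstring of `forceStep`): if at a monomial exactly one hit class has a coefficient of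
one sign and the total over the hit classes is zero, every 0/1-combination of rows with vanishing residual that is constant on
the classes is constant on their union; ending with one class, a closing subset is empty or everything.  Hence `closes n rows b
= true`, `colTable n rows keys b = T` and `rigidCols b T = true` together say that `b` closes and NO proper non-empty subset of
`b` closes.
CONSISTENCY (`rigidCols_consistent`, `rigidCols_consistent_74`): on the 1 + 6 + 42 printed multi-graph sets of 2–4 loops,
`rigidCols` along the column table of the gen-8 certificates `cert2` / `cert3` / `cert4` gives `true`, as `rigid` does
(`volkovSets_minimal_*`).
NOT CLAIMED: as in `VolkovOnShellSets` — the model is formal (operator values are indeterminates, mirror-equality and the two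
Ward identities are the physics input), and the meaning of `closes` / `rigidCols` is the prose above, checked by hand, not a
Lean theorem about all subsets.
-/

namespace Summit.Ventures.QEDPrecision.Diagrams

/-! ## 1. Literal polynomials -/

/-- the key (`monoKey`) of a monomial given STRUCTURALLY as a list of symbols (operator code, word of the reduced graph). -/
def keyOfMono (m : List (ℕ × List ℕ)) : ℕ := monoKey (m.map (fun s => sym s.1 (canonKey s.2)))

/-- a polynomial given structurally, as (monomial, coefficient) pairs, in the canonical sparse form of `pins` / `padd`. -/
def polyOf (l : List (List (ℕ × List ℕ) × ℤ)) : List (ℕ × ℤ) :=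
  l.foldr (fun q acc => pins (keyOfMono q.1) q.2 acc) []

/-- a polynomial given by (position in a table of structural monomials, coefficient) pairs. -/
def polyOfIdx (tbl : List (List (ℕ × List ℕ))) (l : List (ℕ × ℤ)) : List (ℕ × ℤ) :=
  l.foldr (fun q acc => pins (keyOfMono (tbl.getD q.1 [])) q.2 acc) []

/-- sum of a list of polynomials. -/
def psum (ps : List (List (ℕ × ℤ))) : List (ℕ × ℤ) := ps.foldr padd []

/-- `blockResidual` of a concatenation = the fold of the first part started from the value of the second (definitional). -/
theorem blockResidual_append (n : ℕ) (rows : List (ℕ × List (ℕ × ℕ))) (a b : List ℕ) :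
    blockResidual n rows (a ++ b) = a.foldr (fun i acc => padd (rowResidual n rows i) acc) (blockResidual n rows b) := by
  simp only [blockResidual, List.foldr_append]

/-- example: the 2-loop rows 1, 2 (`order4_residuals`) written with `polyOf`. -/
theorem polyOf_example : rowResidual 2 printedRows2 1 = polyOf [([(1, [2,0,2]), (3, [2,0,2])], 2)] ∧
    rowResidual 2 printedRows2 2 = polyOf [([(1, [2,0,2]), (3, [2,0,2])], -2)] := by
  refine ⟨?_, ?_⟩ <;> decide +kernel

/-! ## 2. Column tables and forcing on columns -/

/-- one row's contribution to the column table of the keys `keys`: (row, coefficient) is put on the column of every key with a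
non-zero coefficient in the row's residual. -/
def colStep (n : ℕ) (rows : List (ℕ × List (ℕ × ℕ))) (keys : List ℕ) (i : ℕ) (tbl : List (List (ℕ × ℤ))) :
    List (List (ℕ × ℤ)) :=
  let r := rowResidual n rows i
  List.zipWith (fun k col => let c := coeffOf k r; if c == 0 then col else (i, c) :: col) keys tbl

/-- the COLUMN TABLE of the rows `b`: for each key, the rows of `b` (in the order of `b`) with their non-zero coefficients. -/
def colTable (n : ℕ) (rows : List (ℕ × List (ℕ × ℕ))) (keys : List ℕ) (b : List ℕ) : List (List (ℕ × ℤ)) :=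
  b.foldr (colStep n rows keys) (keys.map (fun _ => []))

/-- `colTable` of a concatenation = the fold of the first part started from the table of the second (definitional). -/
theorem colTable_append (n : ℕ) (rows : List (ℕ × List (ℕ × ℕ))) (keys a b : List ℕ) :
    colTable n rows keys (a ++ b) = a.foldr (colStep n rows keys) (colTable n rows keys b) := by
  simp only [colTable, List.foldr_append]

/-- the columns of a table restricted to the rows in `s` (order kept). -/
def restrictCols (s : List ℕ) (T : List (List (ℕ × ℤ))) : List (List (ℕ × ℤ)) :=
  T.map (fun col => col.filter (fun e => s.contains e.1))

/-- the coefficient of a CLASS of rows in a column: the sum of the class's entries (= the coefficient of the column's monomial in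
the class's residual sum). -/
def classCoeff (col : List (ℕ × ℤ)) (c : List ℕ) : ℤ := col.foldr (fun e s => if c.contains e.1 then e.2 + s else s) 0

/-- `forceStep` read off a column: the classes with non-zero coefficient; if exactly one of those coefficients has one sign and
the total is zero (≥ 2 classes hit), merge them; otherwise leave the partition unchanged. -/
def forceCols (cls : List (List ℕ)) (col : List (ℕ × ℤ)) : List (List ℕ) :=
  let hit := cls.filter (fun c => !(classCoeff col c == 0))
  let pos := hit.filter (fun c => decide (0 < classCoeff col c))
  let neg := hit.filter (fun c => decide (classCoeff col c < 0))
  let total : ℤ := hit.foldr (fun c r => classCoeff col c + r) 0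
  if (pos.length == 1 || neg.length == 1) && total == 0 && Nat.blt 1 hit.length then
    (hit.foldr (fun c r => c ++ r) []) :: cls.filter (fun c => classCoeff col c == 0)
  else cls

/-- the set of rows `b` is RIGID along the column table `T`: starting from single rows, forcing column by column ends with ONE
class (then, `T` being the true column table of `b`, no proper non-empty subset of `b` closes — as `rigid`). -/
def rigidCols (b : List ℕ) (T : List (List (ℕ × ℤ))) : Bool := (T.foldl forceCols (b.map (fun i => [i]))).length == 1

set_option maxHeartbeats 4000000 in
set_option maxRecDepth 40000 in
/-- CONSISTENCY with `rigid`: along the column tables of the gen-8 certificates every printed multi-graph set of 2, 3 and 4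
loops is `rigidCols` (4 loops: the 41 sets after the 74-graph one, in two chunks; the 74-graph set separately below). -/
theorem rigidCols_consistent :
    cert2.all (fun bc => rigidCols bc.1 (colTable 2 printedRows2 (bc.2.map keyOfMono) bc.1)) = true ∧
    cert3.all (fun bc => rigidCols bc.1 (colTable 3 printedRows3 (bc.2.map keyOfMono) bc.1)) = true ∧
    ((cert4.drop 1).take 20).all (fun bc => rigidCols bc.1 (colTable 4 printedRows4 (bc.2.map keyOfMono) bc.1)) = true ∧
    (cert4.drop 21).all (fun bc => rigidCols bc.1 (colTable 4 printedRows4 (bc.2.map keyOfMono) bc.1)) = true := by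
  refine ⟨?_, ?_, ?_, ?_⟩ <;> decide +kernel

set_option maxHeartbeats 4000000 in
set_option maxRecDepth 40000 in
/-- … and the 74-graph set (rows 1–74 of the 4-loop table, class (1;3,0)). -/
theorem rigidCols_consistent_74 :
    (cert4.take 1).all (fun bc => rigidCols bc.1 (colTable 4 printedRows4 (bc.2.map keyOfMono) bc.1)) = true := by
  decide +kernel

end Summit.Ventures.QEDPrecision.Diagrams
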